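import Summits.QuantumFields.BalabanUV.T4Continuum.Spine.NE3.LeafIndexSockets
import Summits.QuantumFields.BalabanUV.T4Continuum.Support.MinimalActionRateExists
import Summits.QuantumFields.BalabanUV.T4Continuum.Support.MinimalActionExistenceCapstone
import Summits.QuantumFields.BalabanUV.T4Continuum.Support.ApproxRefineAssembly

/-!
# T⁴ programme, node NE3 — LEAF INDEX, part 4: the CITED input (H∃) and the two FILLING sockets of route (A), BY NAME

NE3 formalisation swarm, TYPER seat (unit `b2b-balaban-t4-ne3-formalise-typer`, gen 3; DAG `t4/formal/NE3/DAG.md` v1.7,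
leaf table `t4/formal/NE3/LEAVES.md` v1.6).  Parts 1–2 (`Spine.NE3.LeafIndex` p211209, `Spine.NE3.LeafIndexSockets` p212233)
indexed route (A) through the leaves (H1) ∕ (H3ˢᵘᵖ) ∕ (H0) and the refinement sockets R0 (`SmoothRefine`) ∕ R1 (`ApproxRefine`).
Since then three things LANDED that change what route (A) is CONDITIONAL on, and this module indexes them BY NAME:

* the row-NE3 owner's RULING (journal 2026-08-20T07:41:32Z; `Support.MinimalActionRateExists`, p212324): the variational
  input the action sandwich actually CITES is the EXISTENTIAL reading of [Balaban1985Variational] Thm 1 p. 279 —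
  (H∃) «for every datum and every level SOME minimiser exists and lies in the regular space (8)–(9)» — ONE regular
  minimiser per level, no claim about the others; (H1)+(H3ˢᵘᵖ)+(H0) remain sufficient ALTERNATIVES
  (`Support.MinimalActionExistenceCapstone`, p212452, derives (H∃) from them and the kinematic shape);
* crew row R1-asm (`Support.ApproxRefineAssembly`, p212554): SOCKET R1 `ApproxRefine d (sfClass …) L N b c b₁ c₁ m` with the
  CLOSED-FORM `m(d, L, b, c, b₁, c₁)` follows from TWO regularity bounds on the crew's filled pre-compensated configuration
  `fullFill L (precomp L U) (rootH L (precomp L U))` — its small-field bound (hfillS) and its flux-gradient bound (hfillG) —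
  which are therefore the LAST analytic inputs of the kinematic leaf.

Contents:
* `[shape]` `LeafHex` (literally the binder `hmin` of `MinimalActionRateExists.actionRate_sfClass_of_exists_approxRefine`),
  `LeafFillS` ∕ `LeafFillG` (literally the binders `hfillS` ∕ `hfillG` of `ApproxRefineAssembly.approxRefine_of_fillBounds`) —
  hypothesis SHAPES, asserted for no datum and no parameters here;
* `[bookkeeping]` one-line applications of LANDED theorems BY NAME: `leafH1_of_leafHex` (projection),
  `leafHex_of_leaves` (`MinimalActionExistenceCapstone.exists_regular_isMinimiser_of_smoothRefine`: the alternatives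
  (H3ˢᵘᵖ)+(H0)+R0 give (H∃)), `leafR1_of_fillBounds` (`ApproxRefineAssembly.approxRefine_of_fillBounds`: hfillS + hfillG give
  SOCKET R1 with the closed-form `m`), `rootA_sfClass_of_leafHex_approxRefine` (END (44S)
  `MinimalActionRateExists.actionRate_sfClass_of_exists_approxRefine`: (H∃) + R1 give part 1's `RootA`),
  `actionHalf_sfClass₀_of_leafH3sup_approxRefine` (`MinimalActionExistenceCapstone.actionHalf_of_approxRefine_sfClass₀`:
  on data of B11's class (7) the alternatives need only (H3ˢᵘᵖ) + R1), and the composed edge of the DAG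
  `rootA_sfClass_of_leafHex_fillBounds` ((H∃) + hfillS + hfillG ⟹ `RootA`, every numeric side condition kept as a binder —
  the numeric regime is the owner's final assembly, DAG node A15, not decided here).

HONEST FRAMING.  Index ∕ bookkeeping only: no estimate of the cell, no new mathematics, no `def … : Prop` FACT, no
conditional (`BetaPertH`, (B), (B^μ), G-an2-4) used or hidden; nothing here bears on infinite volume, a mass gap, or the
Clay problem.  **NE3 is NOT proved**: `LeafHex` is a B11-Theorem-1-TYPE hypothesis shape (its identification with the
printed minimal orbit of the OPEN space (6) is the crew's dictionary matter, DIVERGENCE entries D-s3-*), and `LeafFillS` ∕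
`LeafFillG` are the crew's OPEN regularity targets for the filling (rows S4d ∕ R1-asm) — every theorem below takes them as
hypotheses.  NE3-(A) for small-field data is CONDITIONAL on ⟨(H∃), hfillS, hfillG⟩ modulo the numeric regime; the local
half (D)∕(F) is untouched; spine estimates PROVED 0∕9; finite `T⁴` rung (B)+1 only.  No `sorry`, no axioms beyond
Mathlib's.  PLACEMENT: `Summits/QuantumFields/BalabanUV/T4Continuum/Spine/NE3/`; imports LANDED modules only
(`Spine.NE3.LeafIndexSockets` p212233, `Support.MinimalActionRateExists` p212324, `Support.MinimalActionExistenceCapstone`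
p212452, `Support.ApproxRefineAssembly` p212554).  HONEST DEPENDENCY (cell page 1): continuum YM on T⁴ ⇐ BetaPertH ∧ nine
spine estimates (0/9 proved); BetaPertH ⇐ (D1) ∧ (D4) ∧ CAP+tail; G-an2-4 gates asym, D1 and NE2/3/4.
-/

set_option autoImplicit false

open scoped BigOperators Matrix Matrix.Norms.L2Operator
open NormedSpace

namespace Summit.QuantumFields.BalabanUV.T4Continuum.NE3.LeafIndexCapstone

open Literature.MathematicalPhysics.QuantumFieldTheory.Balaban1983to89
open B7Prop1Explicit B7Prop2Explicit MatrixLog UnitaryModel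
open T4AveragingDeficitWall hiding Site Plane Plaq Bond
open T4AveragingDeficitWallBoundary (IsPeriodicCfg)
open T4AveragingDeficitNonAbelian (wallConstNA)
open T4EtaRateMin (Readings ActionRate)
open Summit.QuantumFields.BalabanUV.T4Continuum
open MinimalActionSandwich MinimalActionRate MinimalActionRefine ChainEndFix SmoothRefineOfApprox
open MinimalActionRateExists MinimalActionExistenceCapstone ApproxRefineAssembly
open SkeletonFillUnitary SkeletonFillFull SkeletonPrecomp
open NE3.LeafIndex NE3.LeafIndexSockets

noncomputable section

variable {d : ℕ} {n : Type*} [Fintype n] [DecidableEq n]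

/-! ## §1 The CITED variational input (H∃): one regular minimiser per level — shape -/

variable (d) in
/-- `[shape]` **LEAF (H∃)** — for every datum of `dom` and every level `k` SOME minimiser of run `k` over the small-field
class of radius `ε` exists AND has sup-form regularity `(b, c)` ([Balaban1985Variational] Thm 1 p. 279 TYPE: «a minimal
orbit exists and lies in the space (8), with (9)»; the class radius `ε` versus the regularity radius `b` is Thm 1's pair
`ε₀` ∕ `B₃ε₁`).  Literally the binder `hmin` of `MinimalActionRateExists.actionRate_sfClass_of_exists_approxRefine`.
A hypothesis SHAPE, asserted for no datum here; DAG node A-H∃, LEAVES row A-H∃. [folklore] -/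
@[folklore]
def LeafHex (L N : ℕ) (ε b c : ℝ) (dom : Set (B7Prop1Explicit.Site d → Fin d → (Matrix n n ℂ)ˣ)) : Prop :=
  ∀ V ∈ dom, ∀ k : ℕ, ∃ U, IsMinimiser d (sfClass d L N ε) L N k V U ∧ RegularSup d L N b c k U

/-- `[bookkeeping]` (H∃) contains part 1's existence leaf (H1) (first components). [folklore] -/
theorem leafH1_of_leafHex {L N : ℕ} {ε b c : ℝ} {dom : Set (B7Prop1Explicit.Site d → Fin d → (Matrix n n ℂ)ˣ)}
    (h : LeafHex d L N ε b c dom) : LeafH1 d L N ε dom :=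
  fun V hV k => (h V hV k).imp fun _ hU => hU.1

/-- `[bookkeeping]` **THE ALTERNATIVES GIVE THE CITED INPUT**: (H3ˢᵘᵖ) + (H0) + SOCKET R0 (+ the numerics of the
existence theorem, `2 ≤ L`) imply (H∃) — `MinimalActionExistenceCapstone.exists_regular_isMinimiser_of_smoothRefine`
BY NAME (the minimiser EXISTS by compactness of the closed class, and is regular by (H3ˢᵘᵖ) ∕ (H0)). [folklore] -/
theorem leafHex_of_leaves [Nonempty n] {L N : ℕ} (hL : 2 ≤ L) {b c b' c' ε : ℝ} (hbε : b ≤ ε) (hε0 : 0 ≤ ε)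
    (hε1 : 16 * C0 d * ε ≤ 3) (hε2 : 1024 * (d + 1) * (d + 4) * (L : ℝ) ^ 2 * ε ≤ 1)
    {dom : Set (B7Prop1Explicit.Site d → Fin d → (Matrix n n ℂ)ˣ)}
    (h3 : LeafH3sup d L N ε b c dom) (h0 : LeafH0 d L N b c dom) (hR0 : LeafR0 (n := n) d L N ε b c b' c') :
    LeafHex d L N ε b c dom :=
  fun V hV k => exists_regular_isMinimiser_of_smoothRefine hL hbε hε0 hε1 hε2 (h3 V hV) (h0 V hV) hR0 k

/-! ## §2 The two FILLING sockets of leaf R1: hfillS and hfillG — shapes -/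

variable (d) in
/-- `[shape]` **SOCKET hfillS** — the small-field bound, radius `b₁η′²` (`η′ = L^{−(j+1)}`), of the crew's filled
pre-compensated configuration `fullFill L (precomp L U) (rootH L (precomp L U))` of every `(b, c)`-regular `U` of the
class at level `j`.  Literally the binder `hfillS` of `ApproxRefineAssembly.approxRefine_of_fillBounds` (rows S4d ∕ R1-asm:
`SkeletonFillFullSmallField.smallField_fullFill` (p212720) ∘ `ApproxRefineRootData.rootData_precomp` (p212725), composed with
an explicit `b₁(d, L, b, c)` in leaf-09's `ApproxRefineFillSmall.smallField_fill_of_regularSup`, p212939 — at the gate when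
this index was staged, hence not imported).  A hypothesis SHAPE, asserted for no parameters here. [folklore] -/
@[folklore]
def LeafFillS (L N : ℕ) (ε b c b₁ : ℝ) : Prop :=
  ∀ (j : ℕ) (U : B7Prop1Explicit.Site d → Fin d → (Matrix n n ℂ)ˣ), U ∈ sfClass (d := d) L N ε j →
    RegularSup d L N b c j U →
    SmallField (fullFill L (precomp L U) (rootH L (precomp L U))) (b₁ / ((L : ℝ) ^ (j + 1)) ^ 2)

variable (d) in
/-- `[shape]` **SOCKET hfillG** — the flux-gradient bound `c₁η′³` of the same filled configuration at every bond and
plane.  Literally the binder `hfillG` of `ApproxRefineAssembly.approxRefine_of_fillBounds` (row S4d's F4: the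
root-closeness of `fullFill`, cases I–IV — `SkeletonFillFullRoot*`, leaf-04 g2 by arrangement, p212941 at the gate —
then `SkeletonFillFullGradReduce.covGrad_fullFill_le_of_rootClose` (p212766), scaled to level `j` in leaf-09's part 3b).
A hypothesis SHAPE, asserted for no parameters here — the last OPEN analytic input of the kinematic leaf. [folklore] -/
@[folklore]
def LeafFillG (L N : ℕ) (ε b c c₁ : ℝ) : Prop :=
  ∀ (j : ℕ) (U : B7Prop1Explicit.Site d → Fin d → (Matrix n n ℂ)ˣ), U ∈ sfClass (d := d) L N ε j →
    RegularSup d L N b c j U → ∀ (x : B7Prop1Explicit.Site d) (κ : Fin d) (π : T4AveragingDeficitWall.Plane d),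
    ‖covGrad (fullFill L (precomp L U) (rootH L (precomp L U)))
        (flux (fullFill L (precomp L U) (rootH L (precomp L U)))) x κ π‖ ≤ c₁ / ((L : ℝ) ^ (j + 1)) ^ 3

variable (d) in
/-- `[bookkeeping]` the CLOSED-FORM mismatch constant `m(d, L, b, c, b₁, c₁)` of `ApproxRefineAssembly.approxRefine_of_fillBounds`
(an abbreviation of the literal expression in that theorem's conclusion; no estimate). [folklore] -/
@[folklore]
def fillMismatch (L : ℕ) (b c b₁ c₁ : ℝ) : ℝ :=
  3 * (1280 * d * ((d : ℝ) + 1) ^ 2 * ((d : ℝ) + 4) ^ 2 * (L : ℝ) ^ 2 * b₁ ^ 2 + d * ((d : ℝ) + 1) * c₁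
    + ((d : ℝ) - 1) ^ 2 * (c + (37 * ((d : ℝ) - 1) + 4) * b ^ 2))

/-- `[bookkeeping]` **hfillS + hfillG ⟹ SOCKET R1** with `m = fillMismatch d L b c b₁ c₁` —
`ApproxRefineAssembly.approxRefine_of_fillBounds` BY NAME, concluding part 2's `LeafR1`. [folklore] -/
theorem leafR1_of_fillBounds [Nonempty n] (hd1 : 1 ≤ d) (L N : ℕ) (hL : 1 ≤ L) {ε b c b₁ c₁ : ℝ}
    (hb : 0 ≤ b) (hc : 0 ≤ c) (hb₁ : 0 ≤ b₁) (hc₁ : 0 ≤ c₁)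
    (h16 : (8 * (d : ℝ) - 7) * b ≤ 1 / 16) (hhalf : ((d : ℝ) - 1) * b ≤ 1 / 2)
    (hquarter : 2 * (precompCoeff L * (((d : ℝ) - 1) * c)) + 37 * (((d : ℝ) - 1) * b) ^ 2
      + 4 * b * (((d : ℝ) - 1) * b) ≤ 1 / 4)
    (h512 : 512 * (d + 1) * (d + 4) * (L : ℝ) ^ 2 * b₁ ≤ 1)
    (hS : LeafFillS (n := n) d L N ε b c b₁) (hG : LeafFillG (n := n) d L N ε b c c₁) :
    LeafR1 (n := n) d L N ε b c b₁ c₁ (fillMismatch d L b c b₁ c₁) :=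
  approxRefine_of_fillBounds hd1 L N hL hb hc hb₁ hc₁ h16 hhalf hquarter h512 hS hG

/-! ## §3 ROOT-A from the cited input — END (44S) and the capstone BY NAME -/

/-- `[bookkeeping]` **END (44S) indexed**: part 1's `RootA` (NE3's action half, `T4EtaRateMin.ActionRate` with rate
`L⁻²`) for the small-field class of radius `ε` from (H∃) + SOCKET R1, constants `b ↦ max b (b₁ + 8mL³/g)`,
`g ↦ gradConst d (max c (c₁ + 36mL³/g))`, `g = ChainEndFix.gap d L` —
`MinimalActionRateExists.actionRate_sfClass_of_exists_approxRefine` BY NAME.  NE3 is NOT proved: (H∃) and R1 are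
hypothesis shapes. [folklore] -/
theorem rootA_sfClass_of_leafHex_approxRefine [Nonempty n] {L N : ℕ} (hL : 1 ≤ L) (hN : 1 ≤ N)
    {b c b₁ c₁ m ε : ℝ} (hb : 0 ≤ b) (hb₁ : 0 ≤ b₁) (hm : 0 ≤ m)
    (hBs : 512 * (d + 1) * (d + 4) * (L : ℝ) ^ 2 * max b (b₁ + 8 * m * (L : ℝ) ^ 3 / gap d L) ≤ 1)
    (hbε : b + 226 * (8 * (d + 1) * (d + 4)) ^ 2 * b ^ 2 ≤ ε)
    (hbs₁ : 512 * (d + 1) * (d + 4) * (L : ℝ) ^ 2 * b₁ ≤ 1)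
    (hgap : 4 * (2 * (8 * (d + 1) * (d + 4) * (L : ℝ) ^ 2 * b₁) + 2 * m / gap d L) ≤ gap d L)
    (hhalf : b₁ + 8 * m / gap d L ≤ 1 / 2) (hε : b₁ + 8 * m * (L : ℝ) ^ 3 / gap d L ≤ ε)
    {dom : Set (B7Prop1Explicit.Site d → Fin d → (Matrix n n ℂ)ˣ)}
    (hex : LeafHex d L N ε b c dom) (hR1 : LeafR1 (n := n) d L N ε b c b₁ c₁ m)
    {X : Type*} (loc : ℕ → (B7Prop1Explicit.Site d → Fin d → (Matrix n n ℂ)ˣ) → X → ℝ) :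
    RootA d (sfClass d L N ε) L N (max b (b₁ + 8 * m * (L : ℝ) ^ 3 / gap d L))
      (gradConst d (max c (c₁ + 36 * m * (L : ℝ) ^ 3 / gap d L))) dom loc :=
  actionRate_sfClass_of_exists_approxRefine hL hN hb hb₁ hm hBs hbε hbs₁ hgap hhalf hε hex hR1 loc

/-- `[bookkeeping]` **THE ALTERNATIVES ON B11's CLASS (7), indexed**: for data `dom ⊆ sfClass d L N ε₁ 0` the leaves (H1)
and (H0) are theorems, so `0 ≤ L⁻² < 1` and part 1's `RootA` follow from (H3ˢᵘᵖ) + SOCKET R1 (+ numerics, `2 ≤ L`) —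
`MinimalActionExistenceCapstone.actionHalf_of_approxRefine_sfClass₀` BY NAME. [folklore] -/
theorem actionHalf_sfClass₀_of_leafH3sup_approxRefine [Nonempty n] {L N : ℕ} (hL : 2 ≤ L) (hN : 1 ≤ N)
    {b c b₁ c₁ m ε ε₁ : ℝ} (hb : 0 ≤ b) (hb₁ : 0 ≤ b₁) (hm : 0 ≤ m)
    (hBs : 512 * (d + 1) * (d + 4) * (L : ℝ) ^ 2 * max b (b₁ + 8 * m * (L : ℝ) ^ 3 / gap d L) ≤ 1)
    (hbε : b + 226 * (8 * (d + 1) * (d + 4)) ^ 2 * b ^ 2 ≤ ε)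
    (hbs₁ : 512 * (d + 1) * (d + 4) * (L : ℝ) ^ 2 * b₁ ≤ 1)
    (hgap : 4 * (2 * (8 * (d + 1) * (d + 4) * (L : ℝ) ^ 2 * b₁) + 2 * m / gap d L) ≤ gap d L)
    (hhalf : b₁ + 8 * m / gap d L ≤ 1 / 2) (hε : b₁ + 8 * m * (L : ℝ) ^ 3 / gap d L ≤ ε)
    (hε1 : 16 * C0 d * ε ≤ 3) (hε2 : 1024 * (d + 1) * (d + 4) * (L : ℝ) ^ 2 * ε ≤ 1)
    (hε₁ : ε₁ ≤ 1 / 4) (hε₁b : ε₁ ≤ b) (hε₁c : 4 * ε₁ ≤ c)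
    {dom : Set (B7Prop1Explicit.Site d → Fin d → (Matrix n n ℂ)ˣ)} (hdom : dom ⊆ sfClass d L N ε₁ 0)
    (h3 : LeafH3sup d L N ε b c dom) (hR1 : LeafR1 (n := n) d L N ε b c b₁ c₁ m)
    {X : Type*} (loc : ℕ → (B7Prop1Explicit.Site d → Fin d → (Matrix n n ℂ)ˣ) → X → ℝ) :
    0 ≤ ((L : ℝ) ^ 2)⁻¹ ∧ ((L : ℝ) ^ 2)⁻¹ < 1 ∧
      RootA d (sfClass d L N ε) L N (max b (b₁ + 8 * m * (L : ℝ) ^ 3 / gap d L))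
        (gradConst d (max c (c₁ + 36 * m * (L : ℝ) ^ 3 / gap d L))) dom loc :=
  actionHalf_of_approxRefine_sfClass₀ hL hN hb hb₁ hm hBs hbε hbs₁ hgap hhalf hε hε1 hε2 hε₁ hε₁b hε₁c hdom h3 hR1 loc

/-! ## §4 The composed DAG edge: (H∃) + hfillS + hfillG ⟹ ROOT-A, every numeric side condition a binder -/

/-- `[bookkeeping]` **ROUTE (A)'s ACTION HALF FROM THE THREE REMAINING INPUTS**: (H∃) + hfillS + hfillG give part 1's
`RootA` for the small-field class of radius `ε`, with `m = fillMismatch d L b c b₁ c₁` — the composition of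
`leafR1_of_fillBounds` (`ApproxRefineAssembly.approxRefine_of_fillBounds`) with `rootA_sfClass_of_leafHex_approxRefine`
(`MinimalActionRateExists.actionRate_sfClass_of_exists_approxRefine`).  EVERY numeric side condition — including
`0 ≤ m` and the smallness of `b, b₁, m` against `ChainEndFix.gap d L` — is kept as a binder: the numeric regime
(for which `(d, L, b, c, b₁, c₁, ε)` they hold jointly) is the owner's final assembly (DAG node A15), not decided here.
NE3 is NOT proved: (H∃), hfillS, hfillG are hypothesis shapes. [folklore] -/
theorem rootA_sfClass_of_leafHex_fillBounds [Nonempty n] (hd1 : 1 ≤ d) {L N : ℕ} (hL : 1 ≤ L) (hN : 1 ≤ N)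
    {ε b c b₁ c₁ : ℝ} (hb : 0 ≤ b) (hc : 0 ≤ c) (hb₁ : 0 ≤ b₁) (hc₁ : 0 ≤ c₁)
    (h16 : (8 * (d : ℝ) - 7) * b ≤ 1 / 16) (hhalfb : ((d : ℝ) - 1) * b ≤ 1 / 2)
    (hquarter : 2 * (precompCoeff L * (((d : ℝ) - 1) * c)) + 37 * (((d : ℝ) - 1) * b) ^ 2
      + 4 * b * (((d : ℝ) - 1) * b) ≤ 1 / 4)
    (hm : 0 ≤ fillMismatch d L b c b₁ c₁)
    (hBs : 512 * (d + 1) * (d + 4) * (L : ℝ) ^ 2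
      * max b (b₁ + 8 * fillMismatch d L b c b₁ c₁ * (L : ℝ) ^ 3 / gap d L) ≤ 1)
    (hbε : b + 226 * (8 * (d + 1) * (d + 4)) ^ 2 * b ^ 2 ≤ ε)
    (hbs₁ : 512 * (d + 1) * (d + 4) * (L : ℝ) ^ 2 * b₁ ≤ 1)
    (hgap : 4 * (2 * (8 * (d + 1) * (d + 4) * (L : ℝ) ^ 2 * b₁) + 2 * fillMismatch d L b c b₁ c₁ / gap d L)
      ≤ gap d L)
    (hhalf : b₁ + 8 * fillMismatch d L b c b₁ c₁ / gap d L ≤ 1 / 2)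
    (hε : b₁ + 8 * fillMismatch d L b c b₁ c₁ * (L : ℝ) ^ 3 / gap d L ≤ ε)
    {dom : Set (B7Prop1Explicit.Site d → Fin d → (Matrix n n ℂ)ˣ)}
    (hex : LeafHex d L N ε b c dom) (hS : LeafFillS (n := n) d L N ε b c b₁) (hG : LeafFillG (n := n) d L N ε b c c₁)
    {X : Type*} (loc : ℕ → (B7Prop1Explicit.Site d → Fin d → (Matrix n n ℂ)ˣ) → X → ℝ) :
    RootA d (sfClass d L N ε) L N (max b (b₁ + 8 * fillMismatch d L b c b₁ c₁ * (L : ℝ) ^ 3 / gap d L))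
      (gradConst d (max c (c₁ + 36 * fillMismatch d L b c b₁ c₁ * (L : ℝ) ^ 3 / gap d L))) dom loc :=
  rootA_sfClass_of_leafHex_approxRefine hL hN hb hb₁ hm hBs hbε hbs₁ hgap hhalf hε hex
    (leafR1_of_fillBounds hd1 L N hL hb hc hb₁ hc₁ h16 hhalfb hquarter hbs₁ hS hG) loc

end

end Summit.QuantumFields.BalabanUV.T4Continuum.NE3.LeafIndexCapstone
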